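/-
Copyright: harness cell b2b-lgcu-borel (gen 16).  Honest framing: the VALUE here is a THEOREM
(all primes, conditional on the named classical hypothesis `DicksonList` of `DicksonReduction`
where marked) — NOT summit progress; the crux item `SubgroupIdentityDesigns`
(stmt-MatrixMultiplication-14079) stays open and untouched.
-/
import Mathlib
import Summits.MatrixMultiplication.MatrixMultiplication.Theorems.SubgroupIdentityDesigns.Negative.DicksonFamilyI

/-!
# The arithmetic of family I: three coprime scalar parts `≥ 2`, `ω(p-1) ≥ 3`, `p ≡ 1 (mod 4)`

Route `LevelGradedCohnUmans`, crux `SubgroupIdentityDesigns`, negative side, cell `(m,k) = (2,1)`,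
residual range `ε ∈ (0.98, 1]`.  `DicksonFamilyI.familyI_of_images_le` shows (unconditionally,
`p ≥ 7`, `0 < ε ≤ 1`) that a witness triple all of whose members have projective image of order
`≤ p + 1` has images of order EXACTLY `p + 1` and scalar parts `Sᵢ = Hᵢ ∩ Z` multiplying to
`p - 1`; modulo Dickson (`DicksonList p n`, a named hypothesis, NOT proved) the image bounds hold
for `p ≥ 59`.  This file turns the ORDER-PROFILE SIEVE of ORACLE-g16 §G16-2 (DATA for `p ≤ 241`:
family I occurs only at `p ≡ 1 (mod 4)` with `ω(p-1) ≥ 3`) into THEOREMS: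

* UNCONDITIONAL, from the image bounds (`p ≥ 7`, `0 < ε ≤ 1`): `wall_violation`,
  **`witness_scalars_of_images_le`** — `|Hᵢ| = |Sᵢ| (p+1)` exactly (`SingerCycleOrder.
  card_eq_scalar_mul_card_image`), every `|Sᵢ| ≥ 2` (a member with `|Sᵢ| = 1` would put the other
  two ON the pair wall `|H_j||H_k| = (p+1)(p²-1) > (p+1)(p²-1) - 2p` excluded by `StandardLines`),
  the `|Sᵢ|` pairwise coprime (scalar law) with product `p - 1`;
  **`three_le_card_primeFactors_of_images_le`** — hence `ω(p-1) ≥ 3` (the least prime factors of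
  the `|Sᵢ|` are distinct); **`no_levelOne_witness_of_images_le_of_card_primeFactors`** — so NO
  such witness at all when `ω(p-1) ≤ 2`, for every `ε ≤ 1`;
* MOD DICKSON (`p ≥ 59`): `witness_scalars_of_dicksonList`, `three_le_card_primeFactors_of_
  dicksonList`, **`no_levelOne_witness_of_dicksonList_of_card_primeFactors`** — no `(2,1)` witness
  for any `0 < ε ≤ 1` at any prime `p ≥ 59` with `ω(p-1) ≤ 2` (`p = 59, 73, 97, 101, 109, 113, …`);
* MOD DICKSON (`p ≥ 61`): **`witness_arithmetic_of_dicksonList`** — additionally `p ≡ 1 (mod 4)`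
  (every member is conjugate into `N(C)` by `DicksonFamilyI`; one has a scalar part of odd order;
  `SingerCycleOrder.mod_four_of_conj_singerNormal`).

So, modulo Dickson, a `(2,1)` witness for `ε ≤ 1` at `p ≥ 59` can only live at primes `p ≥ 61`
with `p ≡ 1 (mod 4)` and `ω(p-1) ≥ 3` (61, 157, 181, 229, 241, 277, …), as three `N(C_ns)`-type
members `|Hᵢ| = zᵢ(p+1)`, `z₁z₂z₃ = p-1` — and must carry a level-one identity design, which no
TPP triple does at `p = 61` (exhaustive certificate census, ORACLE-g16 §G16-4; DATA, not Lean).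
The explicit `ε`-thresholds and the primes `47, 53` are treated in `CellTwoOneStatus`.

Scope, honestly: conditional on `DicksonList` where stated; decides nothing about the existence of
designs on family-I triples for `p ≥ 157`; VALUE = THEOREM, NOT summit progress; the crux item is
untouched and remains open.  Report: `run/shared/lean/b2b/levelgraded-cu/ORACLE-g16.md` §G16-1/6.
-/

set_option linter.dupNamespace false

noncomputable section

open scoped Classical
open Summit.MatrixMultiplication.MatrixMultiplication.Theorems.LieRankDesigns.Negative (GLm Mat budget)
open Literature.Barriers.MatrixMultiplication (SubgroupTPP)

namespace Summit.MatrixMultiplication.MatrixMultiplication.Theorems.SubgroupIdentityDesigns.Negative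

section FamilyIArithmetic

variable {p : ℕ} [hp : Fact p.Prime]

/-- The PAIR WALL is violated by two members whose scalar parts multiply to `p - 1` and whose
images have order `p + 1`: `(p+1)(p²-1) < a(p+1) · b(p+1) + 2p` when `a b = p - 1`. -/
theorem wall_violation {a b : ℕ} (hab : a * b = p - 1) :
    (p + 1) * (p ^ 2 - 1) < a * (p + 1) * (b * (p + 1)) + 2 * p := by
  have hp1 : 1 ≤ p := hp.out.one_lt.le
  obtain ⟨q, hq⟩ : ∃ q, p = q + 1 := ⟨p - 1, by omega⟩
  have e : a * (p + 1) * (b * (p + 1)) = (p - 1) * (p + 1) * (p + 1) := by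
    rw [← hab]; ring
  have e2 : (p + 1) * (p ^ 2 - 1) = (p - 1) * (p + 1) * (p + 1) := by
    rw [hq, Nat.add_sub_cancel, show (q + 1) ^ 2 = q * (q + 2) + 1 by ring, Nat.add_sub_cancel]
    ring
  rw [e, e2]
  exact Nat.lt_add_of_pos_right (by omega)

/-- **THE SCALAR ARITHMETIC from image bounds** (UNCONDITIONAL, `p ≥ 7`, `0 < ε ≤ 1`).  If all
three members of a subgroup-TPP triple with a level-one identity design satisfying the level-one
crux inequality have projective images of order `≤ p + 1`, then `|Hᵢ| = |Sᵢ| (p+1)` exactly,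
every `|Sᵢ| ≥ 2` (a member with `|Sᵢ| = 1` puts the other two ON the pair wall), and the `|Sᵢ|`
are pairwise coprime with `|S₁||S₂||S₃| = p - 1`. -/
theorem witness_scalars_of_images_le (hp7 : 7 ≤ p) {ε : ℝ} (hε : 0 < ε) (hε1 : ε ≤ 1)
    {H₁ H₂ H₃ : Subgroup (GLm p 2)} (htpp : SubgroupTPP H₁ H₂ H₃)
    (hdesign : ∃ c : Mat p 2 → ℂ, (∀ M, 1 < M.rank → c M = 0) ∧
      (∑ M, c M * ZMod.stdAddChar (Matrix.trace (M * ((1 : GLm p 2) : Mat p 2)))) = 1 ∧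
      ∀ a ∈ H₁, ∀ b ∈ H₂, ∀ g ∈ H₃, a * b * g ≠ 1 →
        (∑ M, c M *
          ZMod.stdAddChar (Matrix.trace (M * ((a * b * g : GLm p 2) : Mat p 2)))) = 0)
    (hwit : budget p 2 1 (2 + ε) <
      ((Nat.card H₁ * Nat.card H₂ * Nat.card H₃ : ℕ) : ℝ) ^ ((2 + ε) / 3))
    (x₁ : Nat.card (H₁.map (QuotientGroup.mk' (scalarHom p 2).range)) ≤ p + 1)
    (x₂ : Nat.card (H₂.map (QuotientGroup.mk' (scalarHom p 2).range)) ≤ p + 1)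
    (x₃ : Nat.card (H₃.map (QuotientGroup.mk' (scalarHom p 2).range)) ≤ p + 1) :
    Nat.card H₁ = Nat.card (H₁.comap (scalarHom p 2)) * (p + 1) ∧
    Nat.card H₂ = Nat.card (H₂.comap (scalarHom p 2)) * (p + 1) ∧
    Nat.card H₃ = Nat.card (H₃.comap (scalarHom p 2)) * (p + 1) ∧
    2 ≤ Nat.card (H₁.comap (scalarHom p 2)) ∧ 2 ≤ Nat.card (H₂.comap (scalarHom p 2)) ∧
    2 ≤ Nat.card (H₃.comap (scalarHom p 2)) ∧
    Nat.Coprime (Nat.card (H₁.comap (scalarHom p 2))) (Nat.card (H₂.comap (scalarHom p 2))) ∧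
    Nat.Coprime (Nat.card (H₁.comap (scalarHom p 2))) (Nat.card (H₃.comap (scalarHom p 2))) ∧
    Nat.Coprime (Nat.card (H₂.comap (scalarHom p 2))) (Nat.card (H₃.comap (scalarHom p 2))) ∧
    Nat.card (H₁.comap (scalarHom p 2)) * Nat.card (H₂.comap (scalarHom p 2)) *
      Nat.card (H₃.comap (scalarHom p 2)) = p - 1 := by
  obtain ⟨e₁, e₂, e₃, hS⟩ := familyI_of_images_le hp7 hε hε1 htpp hwit x₁ x₂ x₃
  obtain ⟨c12, c13, c23, -⟩ := scalar_law htpp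
  set s₁ := Nat.card (H₁.comap (scalarHom p 2)) with hs₁
  set s₂ := Nat.card (H₂.comap (scalarHom p 2)) with hs₂
  set s₃ := Nat.card (H₃.comap (scalarHom p 2)) with hs₃
  have k₁ : Nat.card H₁ = s₁ * (p + 1) := by rw [hs₁, card_eq_scalar_mul_card_image H₁, e₁]
  have k₂ : Nat.card H₂ = s₂ * (p + 1) := by rw [hs₂, card_eq_scalar_mul_card_image H₂, e₂]
  have k₃ : Nat.card H₃ = s₃ * (p + 1) := by rw [hs₃, card_eq_scalar_mul_card_image H₃, e₃]
  have hwall := fun h => StandardLines.no_levelOne_design_of_walls H₁ H₂ H₃ htpp h hdesign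
  have pos₁ : 0 < s₁ := Nat.card_pos
  have pos₂ : 0 < s₂ := Nat.card_pos
  have pos₃ : 0 < s₃ := Nat.card_pos
  have two₁ : 2 ≤ s₁ := by
    by_contra hlt
    have h1 : s₁ = 1 := by omega
    have h23 : s₂ * s₃ = p - 1 := by rw [h1, one_mul] at hS; exact hS
    exact hwall (Or.inr (Or.inr (by rw [k₂, k₃]; exact wall_violation h23)))
  have two₂ : 2 ≤ s₂ := by
    by_contra hlt
    have h1 : s₂ = 1 := by omega
    have h13 : s₁ * s₃ = p - 1 := by rw [h1, mul_one] at hS; exact hS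
    exact hwall (Or.inl (by rw [k₁, k₃]; exact wall_violation h13))
  have two₃ : 2 ≤ s₃ := by
    by_contra hlt
    have h1 : s₃ = 1 := by omega
    have h12 : s₁ * s₂ = p - 1 := by rw [h1, mul_one] at hS; exact hS
    exact hwall (Or.inr (Or.inl (by rw [k₁, k₂]; exact wall_violation h12)))
  exact ⟨k₁, k₂, k₃, two₁, two₂, two₃, c12, c13, c23, hS⟩

/-- **`ω(p - 1) ≥ 3` from image bounds** (UNCONDITIONAL, `p ≥ 7`, `0 < ε ≤ 1`): under the
hypotheses of `witness_scalars_of_images_le`, `p - 1` has at least three distinct prime factors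
(the least prime factors of the three scalar parts). -/
theorem three_le_card_primeFactors_of_images_le (hp7 : 7 ≤ p) {ε : ℝ} (hε : 0 < ε)
    (hε1 : ε ≤ 1) {H₁ H₂ H₃ : Subgroup (GLm p 2)} (htpp : SubgroupTPP H₁ H₂ H₃)
    (hdesign : ∃ c : Mat p 2 → ℂ, (∀ M, 1 < M.rank → c M = 0) ∧
      (∑ M, c M * ZMod.stdAddChar (Matrix.trace (M * ((1 : GLm p 2) : Mat p 2)))) = 1 ∧
      ∀ a ∈ H₁, ∀ b ∈ H₂, ∀ g ∈ H₃, a * b * g ≠ 1 →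
        (∑ M, c M *
          ZMod.stdAddChar (Matrix.trace (M * ((a * b * g : GLm p 2) : Mat p 2)))) = 0)
    (hwit : budget p 2 1 (2 + ε) <
      ((Nat.card H₁ * Nat.card H₂ * Nat.card H₃ : ℕ) : ℝ) ^ ((2 + ε) / 3))
    (x₁ : Nat.card (H₁.map (QuotientGroup.mk' (scalarHom p 2).range)) ≤ p + 1)
    (x₂ : Nat.card (H₂.map (QuotientGroup.mk' (scalarHom p 2).range)) ≤ p + 1)
    (x₃ : Nat.card (H₃.map (QuotientGroup.mk' (scalarHom p 2).range)) ≤ p + 1) :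
    3 ≤ (p - 1).primeFactors.card := by
  obtain ⟨-, -, -, two₁, two₂, two₃, c12, c13, c23, hS⟩ :=
    witness_scalars_of_images_le hp7 hε hε1 htpp hdesign hwit x₁ x₂ x₃
  set s₁ := Nat.card (H₁.comap (scalarHom p 2))
  set s₂ := Nat.card (H₂.comap (scalarHom p 2))
  set s₃ := Nat.card (H₃.comap (scalarHom p 2))
  have hp1 : p - 1 ≠ 0 := by omega
  -- the least prime factors q_i of s_i are three distinct prime factors of p - 1
  have hq : ∀ {s t u : ℕ}, 2 ≤ s → s * t * u = p - 1 → s.minFac ∈ (p - 1).primeFactors := by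
    intro s t u hs hstu
    rw [Nat.mem_primeFactors]
    exact ⟨Nat.minFac_prime (by omega), (Nat.minFac_dvd s).trans ⟨t * u, by rw [← hstu]; ring⟩,
      hp1⟩
  have hq₁ := hq two₁ hS
  have hq₂ := hq two₂ (show s₂ * s₁ * s₃ = p - 1 by rw [← hS]; ring)
  have hq₃ := hq two₃ (show s₃ * s₁ * s₂ = p - 1 by rw [← hS]; ring)
  have hne : ∀ {s t : ℕ}, 2 ≤ s → 2 ≤ t → Nat.Coprime s t → s.minFac ≠ t.minFac := by
    intro s t hs ht hst h
    have h1 : s.minFac ∣ Nat.gcd s t :=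
      Nat.dvd_gcd (Nat.minFac_dvd s) (h ▸ Nat.minFac_dvd t)
    rw [hst] at h1
    exact (Nat.minFac_prime (by omega)).ne_one (Nat.dvd_one.mp h1)
  have h12 := hne two₁ two₂ c12
  have h13 := hne two₁ two₃ c13
  have h23 := hne two₂ two₃ c23
  have hsub : ({s₁.minFac, s₂.minFac, s₃.minFac} : Finset ℕ) ⊆ (p - 1).primeFactors := by
    intro q hq'
    simp only [Finset.mem_insert, Finset.mem_singleton] at hq'
    rcases hq' with rfl | rfl | rfl
    · exact hq₁
    · exact hq₂
    · exact hq₃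
  have hcard : ({s₁.minFac, s₂.minFac, s₃.minFac} : Finset ℕ).card = 3 := by
    rw [Finset.card_insert_of_notMem, Finset.card_insert_of_notMem, Finset.card_singleton]
    · simpa using h23
    · simp only [Finset.mem_insert, Finset.mem_singleton, not_or]; exact ⟨h12, h13⟩
  exact hcard ▸ Finset.card_le_card hsub

/-- **NO WITNESS WHEN `ω(p - 1) ≤ 2`, from image bounds** (UNCONDITIONAL, `p ≥ 7`, all
`0 < ε ≤ 1`): a subgroup-TPP triple with a level-one identity design all of whose members have
projective image of order `≤ p + 1` does not satisfy the level-one crux inequality if `p - 1` has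
at most two distinct prime factors. -/
theorem no_levelOne_witness_of_images_le_of_card_primeFactors (hp7 : 7 ≤ p)
    (hω : (p - 1).primeFactors.card ≤ 2) {ε : ℝ} (hε : 0 < ε) (hε1 : ε ≤ 1)
    {H₁ H₂ H₃ : Subgroup (GLm p 2)} (htpp : SubgroupTPP H₁ H₂ H₃)
    (hdesign : ∃ c : Mat p 2 → ℂ, (∀ M, 1 < M.rank → c M = 0) ∧
      (∑ M, c M * ZMod.stdAddChar (Matrix.trace (M * ((1 : GLm p 2) : Mat p 2)))) = 1 ∧
      ∀ a ∈ H₁, ∀ b ∈ H₂, ∀ g ∈ H₃, a * b * g ≠ 1 →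
        (∑ M, c M *
          ZMod.stdAddChar (Matrix.trace (M * ((a * b * g : GLm p 2) : Mat p 2)))) = 0)
    (x₁ : Nat.card (H₁.map (QuotientGroup.mk' (scalarHom p 2).range)) ≤ p + 1)
    (x₂ : Nat.card (H₂.map (QuotientGroup.mk' (scalarHom p 2).range)) ≤ p + 1)
    (x₃ : Nat.card (H₃.map (QuotientGroup.mk' (scalarHom p 2).range)) ≤ p + 1) :
    ¬ budget p 2 1 (2 + ε) <
      ((Nat.card H₁ * Nat.card H₂ * Nat.card H₃ : ℕ) : ℝ) ^ ((2 + ε) / 3) := by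
  intro hwit
  have h3 := three_le_card_primeFactors_of_images_le hp7 hε hε1 htpp hdesign hwit x₁ x₂ x₃
  omega

/-- **THE ARITHMETIC OF FAMILY I** (mod Dickson; `p ≥ 59`, `0 < ε ≤ 1`): for a subgroup-TPP
triple with a level-one identity design satisfying the level-one crux inequality,
`|Hᵢ| = |Sᵢ| (p+1)` exactly, every `|Sᵢ| ≥ 2`, the `|Sᵢ|` pairwise coprime with
`|S₁||S₂||S₃| = p - 1`. -/
theorem witness_scalars_of_dicksonList (hp59 : 59 ≤ p) {n : ZMod p}
    (hn : ∀ x : ZMod p, x * x ≠ n) (hD : DicksonList p n)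
    {ε : ℝ} (hε : 0 < ε) (hε1 : ε ≤ 1)
    {H₁ H₂ H₃ : Subgroup (GLm p 2)} (htpp : SubgroupTPP H₁ H₂ H₃)
    (hdesign : ∃ c : Mat p 2 → ℂ, (∀ M, 1 < M.rank → c M = 0) ∧
      (∑ M, c M * ZMod.stdAddChar (Matrix.trace (M * ((1 : GLm p 2) : Mat p 2)))) = 1 ∧
      ∀ a ∈ H₁, ∀ b ∈ H₂, ∀ g ∈ H₃, a * b * g ≠ 1 →
        (∑ M, c M *
          ZMod.stdAddChar (Matrix.trace (M * ((a * b * g : GLm p 2) : Mat p 2)))) = 0)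
    (hwit : budget p 2 1 (2 + ε) <
      ((Nat.card H₁ * Nat.card H₂ * Nat.card H₃ : ℕ) : ℝ) ^ ((2 + ε) / 3))
 :
    Nat.card H₁ = Nat.card (H₁.comap (scalarHom p 2)) * (p + 1) ∧
    Nat.card H₂ = Nat.card (H₂.comap (scalarHom p 2)) * (p + 1) ∧
    Nat.card H₃ = Nat.card (H₃.comap (scalarHom p 2)) * (p + 1) ∧
    2 ≤ Nat.card (H₁.comap (scalarHom p 2)) ∧ 2 ≤ Nat.card (H₂.comap (scalarHom p 2)) ∧
    2 ≤ Nat.card (H₃.comap (scalarHom p 2)) ∧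
    Nat.Coprime (Nat.card (H₁.comap (scalarHom p 2))) (Nat.card (H₂.comap (scalarHom p 2))) ∧
    Nat.Coprime (Nat.card (H₁.comap (scalarHom p 2))) (Nat.card (H₃.comap (scalarHom p 2))) ∧
    Nat.Coprime (Nat.card (H₂.comap (scalarHom p 2))) (Nat.card (H₃.comap (scalarHom p 2))) ∧
    Nat.card (H₁.comap (scalarHom p 2)) * Nat.card (H₂.comap (scalarHom p 2)) *
      Nat.card (H₃.comap (scalarHom p 2)) = p - 1 := by
  have hp3 : 3 ≤ p := by omega
  obtain ⟨-, pf₁, pf₂, pf₃⟩ := levelOne_witness_pfree_profile hp3 hε hε1 htpp hdesign hwit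
  obtain ⟨fv₁, fv₂, fv₃⟩ := levelOne_witness_free_vector hp3 hε hε1 htpp hdesign hwit
  exact witness_scalars_of_images_le (by omega) hε hε1 htpp hdesign hwit
    (image_le_of_dicksonList hp59 hn hD pf₁ fv₁) (image_le_of_dicksonList hp59 hn hD pf₂ fv₂)
    (image_le_of_dicksonList hp59 hn hD pf₃ fv₃)

/-- **`ω(p - 1) ≥ 3`, mod Dickson** (`p ≥ 59`, `0 < ε ≤ 1`): a witness forces `p - 1` to have at
least three distinct prime factors. -/
theorem three_le_card_primeFactors_of_dicksonList (hp59 : 59 ≤ p) {n : ZMod p}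
    (hn : ∀ x : ZMod p, x * x ≠ n) (hD : DicksonList p n)
    {ε : ℝ} (hε : 0 < ε) (hε1 : ε ≤ 1)
    {H₁ H₂ H₃ : Subgroup (GLm p 2)} (htpp : SubgroupTPP H₁ H₂ H₃)
    (hdesign : ∃ c : Mat p 2 → ℂ, (∀ M, 1 < M.rank → c M = 0) ∧
      (∑ M, c M * ZMod.stdAddChar (Matrix.trace (M * ((1 : GLm p 2) : Mat p 2)))) = 1 ∧
      ∀ a ∈ H₁, ∀ b ∈ H₂, ∀ g ∈ H₃, a * b * g ≠ 1 →
        (∑ M, c M *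
          ZMod.stdAddChar (Matrix.trace (M * ((a * b * g : GLm p 2) : Mat p 2)))) = 0)
    (hwit : budget p 2 1 (2 + ε) <
      ((Nat.card H₁ * Nat.card H₂ * Nat.card H₃ : ℕ) : ℝ) ^ ((2 + ε) / 3))
 :
    3 ≤ (p - 1).primeFactors.card := by
  have hp3 : 3 ≤ p := by omega
  obtain ⟨-, pf₁, pf₂, pf₃⟩ := levelOne_witness_pfree_profile hp3 hε hε1 htpp hdesign hwit
  obtain ⟨fv₁, fv₂, fv₃⟩ := levelOne_witness_free_vector hp3 hε hε1 htpp hdesign hwit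
  exact three_le_card_primeFactors_of_images_le (by omega) hε hε1 htpp hdesign hwit
    (image_le_of_dicksonList hp59 hn hD pf₁ fv₁) (image_le_of_dicksonList hp59 hn hD pf₂ fv₂)
    (image_le_of_dicksonList hp59 hn hD pf₃ fv₃)

/-- **NO `(2,1)` WITNESS WHEN `ω(p - 1) ≤ 2`, mod Dickson** (`p ≥ 59`, all `0 < ε ≤ 1`) — kills
e.g. `p = 59, 73, 97, 101, 109, 113, 137, 149, 163, 173, 193, 197, 233, …` for every `ε ≤ 1`. -/
theorem no_levelOne_witness_of_dicksonList_of_card_primeFactors (hp59 : 59 ≤ p)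
    (hω : (p - 1).primeFactors.card ≤ 2) {n : ZMod p}
    (hn : ∀ x : ZMod p, x * x ≠ n) (hD : DicksonList p n)
    {ε : ℝ} (hε : 0 < ε) (hε1 : ε ≤ 1)
    {H₁ H₂ H₃ : Subgroup (GLm p 2)} (htpp : SubgroupTPP H₁ H₂ H₃)
    (hdesign : ∃ c : Mat p 2 → ℂ, (∀ M, 1 < M.rank → c M = 0) ∧
      (∑ M, c M * ZMod.stdAddChar (Matrix.trace (M * ((1 : GLm p 2) : Mat p 2)))) = 1 ∧
      ∀ a ∈ H₁, ∀ b ∈ H₂, ∀ g ∈ H₃, a * b * g ≠ 1 →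
        (∑ M, c M *
          ZMod.stdAddChar (Matrix.trace (M * ((a * b * g : GLm p 2) : Mat p 2)))) = 0)
 :
    ¬ budget p 2 1 (2 + ε) <
      ((Nat.card H₁ * Nat.card H₂ * Nat.card H₃ : ℕ) : ℝ) ^ ((2 + ε) / 3) := by
  intro hwit
  have h3 := three_le_card_primeFactors_of_dicksonList hp59 hn hD hε hε1 htpp hdesign hwit
  omega

/-- **THE ARITHMETIC OF FAMILY I with `p ≡ 1 (mod 4)`** (mod Dickson; `p ≥ 61`, `0 < ε ≤ 1`):
a witness forces `p ≡ 1 (mod 4)` together with the scalar arithmetic of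
`witness_scalars_of_dicksonList` (every member is conjugate into `N(C)`, and one of them has a
scalar part of odd order). -/
theorem witness_arithmetic_of_dicksonList (hp61 : 61 ≤ p) {n : ZMod p}
    (hn : ∀ x : ZMod p, x * x ≠ n) (hD : DicksonList p n)
    {ε : ℝ} (hε : 0 < ε) (hε1 : ε ≤ 1)
    {H₁ H₂ H₃ : Subgroup (GLm p 2)} (htpp : SubgroupTPP H₁ H₂ H₃)
    (hdesign : ∃ c : Mat p 2 → ℂ, (∀ M, 1 < M.rank → c M = 0) ∧
      (∑ M, c M * ZMod.stdAddChar (Matrix.trace (M * ((1 : GLm p 2) : Mat p 2)))) = 1 ∧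
      ∀ a ∈ H₁, ∀ b ∈ H₂, ∀ g ∈ H₃, a * b * g ≠ 1 →
        (∑ M, c M *
          ZMod.stdAddChar (Matrix.trace (M * ((a * b * g : GLm p 2) : Mat p 2)))) = 0)
    (hwit : budget p 2 1 (2 + ε) <
      ((Nat.card H₁ * Nat.card H₂ * Nat.card H₃ : ℕ) : ℝ) ^ ((2 + ε) / 3))
 :
    p % 4 = 1 ∧
    Nat.card H₁ = Nat.card (H₁.comap (scalarHom p 2)) * (p + 1) ∧
    Nat.card H₂ = Nat.card (H₂.comap (scalarHom p 2)) * (p + 1) ∧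
    Nat.card H₃ = Nat.card (H₃.comap (scalarHom p 2)) * (p + 1) ∧
    2 ≤ Nat.card (H₁.comap (scalarHom p 2)) ∧ 2 ≤ Nat.card (H₂.comap (scalarHom p 2)) ∧
    2 ≤ Nat.card (H₃.comap (scalarHom p 2)) ∧
    Nat.Coprime (Nat.card (H₁.comap (scalarHom p 2))) (Nat.card (H₂.comap (scalarHom p 2))) ∧
    Nat.Coprime (Nat.card (H₁.comap (scalarHom p 2))) (Nat.card (H₃.comap (scalarHom p 2))) ∧
    Nat.Coprime (Nat.card (H₂.comap (scalarHom p 2))) (Nat.card (H₃.comap (scalarHom p 2))) ∧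
    Nat.card (H₁.comap (scalarHom p 2)) * Nat.card (H₂.comap (scalarHom p 2)) *
      Nat.card (H₃.comap (scalarHom p 2)) = p - 1 := by
  have hp59 : 59 ≤ p := by omega
  have hp2 : p ≠ 2 := by omega
  obtain ⟨e₁, e₂, -, -⟩ := witness_familyI_of_dicksonList hp59 hn hD hε hε1 htpp hdesign hwit
  obtain ⟨⟨g₁, c₁⟩, ⟨g₂, c₂⟩, -⟩ :=
    witness_conj_singerNormal_of_dicksonList hp61 hn hD hε hε1 htpp hdesign hwit
  obtain ⟨k₁, k₂, k₃, two₁, two₂, two₃, c12, c13, c23, hS⟩ :=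
    witness_scalars_of_dicksonList hp59 hn hD hε hε1 htpp hdesign hwit
  -- a member with odd scalar part gives p ≡ 1 (mod 4)
  have hmod : p % 4 = 1 := by
    rcases Nat.even_or_odd (Nat.card (H₁.comap (scalarHom p 2))) with hev | hodd
    · have hodd₂ : Odd (Nat.card (H₂.comap (scalarHom p 2))) := by
        by_contra hev₂
        rw [Nat.not_odd_iff_even] at hev₂
        have h2 : 2 ∣ Nat.gcd (Nat.card (H₁.comap (scalarHom p 2)))
            (Nat.card (H₂.comap (scalarHom p 2))) :=
          Nat.dvd_gcd (even_iff_two_dvd.mp hev) (even_iff_two_dvd.mp hev₂)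
        rw [c12] at h2
        exact absurd (Nat.le_of_dvd one_pos h2) (by norm_num)
      exact mod_four_of_conj_singerNormal hp2 hn c₂ e₂ hodd₂
    · exact mod_four_of_conj_singerNormal hp2 hn c₁ e₁ hodd
  exact ⟨hmod, k₁, k₂, k₃, two₁, two₂, two₃, c12, c13, c23, hS⟩

end FamilyIArithmetic

end Summit.MatrixMultiplication.MatrixMultiplication.Theorems.SubgroupIdentityDesigns.Negative

end
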